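import Mathlib

/-!
# PneNP / OverlapGapAlgebra — crux `SolvableImpliesStableSection` (stmt-PneNP-2463):
# the UNIT CLAUSE block (6/·) — counting clause contents against a frozen trajectory

Support for crux `stmt-PneNP-2463` (`Summit.PneNP.PneNP.Theses.OverlapGapAlgebra.SolvableImpliesStableSection`),
registered stub `stub_lowDensity` (child G).  After muting, the content `x : Fin k → Fin n × Bool` of a
clause is a uniform clause independent of the states it is tested against, and "clause unit at round
`t`" becomes: one slot carries an unset variable (literal in `A`), every other slot a false literal (in
`C`), and some other slot a literal set during the last round (in `B`).  This file counts such
contents: product sets with two distinguished slots, the unit-like contents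
(`≤ k²·|A|·|B|·|C|^{k-2}`), and a fibrewise bound for pairs used by the coupled (same-variable) counts.

* `sissU_card_pi_two_slots`, `sissU_card_unitlike_le`, `sissU_card_pairs_le`, `sissU_card_lit_fibre`.
Pure finite combinatorics; no definitions; axioms `propext`, `Classical.choice`, `Quot.sound`.
-/

set_option linter.dupNamespace false -- `Summit.PneNP.PneNP.…`: summit = sub-problem (D-0017)

namespace Summit.PneNP.PneNP.Theorems

open Finset
open scoped Classical

section Count

variable {k : ℕ} {L : Type*} [Fintype L] [DecidableEq L]

omit [Fintype L] [DecidableEq L] in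
/-- **Product sets with two distinguished slots.** For slots `j ≠ j'` the contents with slot `j` in `A`,
slot `j'` in `B` and every other slot in `C` number `|A|·|B|·|C|^{k-2}`. -/
theorem sissU_card_pi_two_slots (j j' : Fin k) (hjj' : j ≠ j') (A B C : Finset L) :
    (Fintype.piFinset fun j'' : Fin k => if j'' = j then A else if j'' = j' then B else C).card =
      A.card * B.card * C.card ^ (k - 2) := by
  rw [Fintype.card_piFinset]
  rw [← Finset.mul_prod_erase univ _ (mem_univ j), if_pos rfl]
  rw [← Finset.mul_prod_erase (univ.erase j) _ (by rw [mem_erase]; exact ⟨hjj'.symm, mem_univ j'⟩)]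
  rw [if_neg hjj'.symm, if_pos rfl]
  have hrest : ∀ j'' ∈ (univ.erase j).erase j', (if j'' = j then A else if j'' = j' then B else C).card
      = C.card := by
    intro j'' hj''
    rw [mem_erase, mem_erase] at hj''
    rw [if_neg hj''.2.1, if_neg hj''.1]
  rw [prod_congr rfl hrest, prod_const, card_erase_of_mem (by rw [mem_erase]; exact ⟨hjj'.symm, mem_univ j'⟩),
    card_erase_of_mem (mem_univ j), card_univ, Fintype.card_fin, mul_assoc]
  have hk2 : k - 1 - 1 = k - 2 := by omega
  rw [hk2]

/-- **Unit-like contents.** The contents `x` having a slot `j` with `x j ∈ A`, all other slots in `C`,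
and some other slot in `B`, number at most `k²·|A|·|B|·|C|^{k-2}`. -/
theorem sissU_card_unitlike_le (A B C : Finset L) :
    ((univ : Finset (Fin k → L)).filter fun x => ∃ j : Fin k, x j ∈ A ∧ (∀ j'' : Fin k, j'' ≠ j → x j'' ∈ C) ∧
        ∃ j' : Fin k, j' ≠ j ∧ x j' ∈ B).card ≤ k * k * (A.card * B.card * C.card ^ (k - 2)) := by
  calc ((univ : Finset (Fin k → L)).filter fun x => ∃ j : Fin k, x j ∈ A ∧ (∀ j'' : Fin k, j'' ≠ j → x j'' ∈ C) ∧
        ∃ j' : Fin k, j' ≠ j ∧ x j' ∈ B).card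
      ≤ ((univ : Finset (Fin k)).offDiag.biUnion fun p =>
          Fintype.piFinset fun j'' : Fin k => if j'' = p.1 then A else if j'' = p.2 then B else C).card := by
        refine card_le_card fun x hx => ?_
        rw [mem_filter] at hx
        obtain ⟨-, j, hjA, hC, j', hj'j, hj'B⟩ := hx
        rw [mem_biUnion]
        refine ⟨(j, j'), by rw [mem_offDiag]; exact ⟨mem_univ _, mem_univ _, hj'j.symm⟩, ?_⟩
        rw [Fintype.mem_piFinset]
        intro j''
        dsimp only
        split_ifs with h1 h2
        · rw [h1]; exact hjA
        · rw [h2]; exact hj'B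
        · exact hC j'' h1
    _ ≤ ∑ p ∈ (univ : Finset (Fin k)).offDiag,
          (Fintype.piFinset fun j'' : Fin k => if j'' = p.1 then A else if j'' = p.2 then B else C).card :=
        card_biUnion_le
    _ = ∑ p ∈ (univ : Finset (Fin k)).offDiag, A.card * B.card * C.card ^ (k - 2) := by
        refine sum_congr rfl fun p hp => ?_
        rw [mem_offDiag] at hp
        exact sissU_card_pi_two_slots p.1 p.2 hp.2.2 A B C
    _ ≤ k * k * (A.card * B.card * C.card ^ (k - 2)) := by
        rw [sum_const, smul_eq_mul, offDiag_card, card_univ, Fintype.card_fin]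
        exact Nat.mul_le_mul_right _ (Nat.sub_le _ _)

omit [DecidableEq L] in
/-- **Fibrewise bound for pairs.** If every `x ∈ P` has a fibre `Q x` of size at most `K`, the pairs
`(x, y)` with `x ∈ P` and `y ∈ Q x` number at most `|P|·K`. -/
theorem sissU_card_pairs_le {X Y : Type*} [Fintype X] [Fintype Y] (P : Finset X) (Q : X → Finset Y)
    (K : ℕ) (hQ : ∀ x ∈ P, (Q x).card ≤ K) :
    ((univ : Finset (X × Y)).filter fun p => p.1 ∈ P ∧ p.2 ∈ Q p.1).card ≤ P.card * K := by
  have heq : ((univ : Finset (X × Y)).filter fun p => p.1 ∈ P ∧ p.2 ∈ Q p.1)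
      = (P.sigma Q).map ⟨fun s => (s.1, s.2), fun a b h => by
          rcases a with ⟨a1, a2⟩; rcases b with ⟨b1, b2⟩
          simp only [Prod.mk.injEq] at h
          obtain ⟨rfl, rfl⟩ := h; rfl⟩ := by
    ext ⟨x, y⟩
    simp only [mem_filter, mem_univ, true_and, mem_map, mem_sigma, Function.Embedding.coeFn_mk,
      Prod.mk.injEq, Sigma.exists]
    constructor
    · rintro ⟨hx, hy⟩; exact ⟨x, y, ⟨hx, hy⟩, rfl, rfl⟩
    · rintro ⟨a, b, ⟨ha, hb⟩, rfl, rfl⟩; exact ⟨ha, hb⟩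
  rw [heq, card_map, card_sigma]
  exact (sum_le_sum hQ).trans (by rw [sum_const, smul_eq_mul])

/-- **Literals on a given variable.** For every variable `w : Fin n` exactly two literals sit on `w`. -/
theorem sissU_card_lit_fibre {n : ℕ} (w : Fin n) :
    ((univ : Finset (Fin n × Bool)).filter fun ℓ => ℓ.1 = w).card = 2 := by
  have : ((univ : Finset (Fin n × Bool)).filter fun ℓ => ℓ.1 = w) = ({w} : Finset (Fin n)) ×ˢ univ := by
    ext ⟨a, b⟩
    simp only [mem_filter, mem_univ, true_and, mem_product, mem_singleton, and_true]
  rw [this, card_product, card_singleton, card_univ, Fintype.card_bool]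

/-- **Literals on a set of variables.** The literals whose variable lies in `U` number `2·|U|`. -/
theorem sissU_card_lit_on {n : ℕ} (U : Finset (Fin n)) :
    ((univ : Finset (Fin n × Bool)).filter fun ℓ => ℓ.1 ∈ U).card = 2 * U.card := by
  have : ((univ : Finset (Fin n × Bool)).filter fun ℓ => ℓ.1 ∈ U) = U ×ˢ univ := by
    ext ⟨a, b⟩
    simp only [mem_filter, mem_univ, true_and, mem_product, and_true]
  rw [this, card_product, card_univ, Fintype.card_bool, mul_comm]

end Count


section CountSharp

variable {k : ℕ} {L : Type*} [Fintype L] [DecidableEq L]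

/-- **Unit-like contents, sharp slot-pair count.** As `sissU_card_unitlike_le` with the exact number
`k² - k` of ordered pairs of distinct slots (the constant enters the unit-clause threshold). -/
theorem sissU_card_unitlike_le' (A B C : Finset L) :
    ((univ : Finset (Fin k → L)).filter fun x => ∃ j : Fin k, x j ∈ A ∧ (∀ j'' : Fin k, j'' ≠ j → x j'' ∈ C) ∧
        ∃ j' : Fin k, j' ≠ j ∧ x j' ∈ B).card ≤ (k * k - k) * (A.card * B.card * C.card ^ (k - 2)) := by
  calc ((univ : Finset (Fin k → L)).filter fun x => ∃ j : Fin k, x j ∈ A ∧ (∀ j'' : Fin k, j'' ≠ j → x j'' ∈ C) ∧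
        ∃ j' : Fin k, j' ≠ j ∧ x j' ∈ B).card
      ≤ ((univ : Finset (Fin k)).offDiag.biUnion fun p =>
          Fintype.piFinset fun j'' : Fin k => if j'' = p.1 then A else if j'' = p.2 then B else C).card := by
        refine card_le_card fun x hx => ?_
        rw [mem_filter] at hx
        obtain ⟨-, j, hjA, hC, j', hj'j, hj'B⟩ := hx
        rw [mem_biUnion]
        refine ⟨(j, j'), by rw [mem_offDiag]; exact ⟨mem_univ _, mem_univ _, hj'j.symm⟩, ?_⟩
        rw [Fintype.mem_piFinset]
        intro j''
        dsimp only
        split_ifs with h1 h2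
        · rw [h1]; exact hjA
        · rw [h2]; exact hj'B
        · exact hC j'' h1
    _ ≤ ∑ p ∈ (univ : Finset (Fin k)).offDiag,
          (Fintype.piFinset fun j'' : Fin k => if j'' = p.1 then A else if j'' = p.2 then B else C).card :=
        card_biUnion_le
    _ = ∑ p ∈ (univ : Finset (Fin k)).offDiag, A.card * B.card * C.card ^ (k - 2) := by
        refine sum_congr rfl fun p hp => ?_
        rw [mem_offDiag] at hp
        exact sissU_card_pi_two_slots p.1 p.2 hp.2.2 A B C
    _ = (k * k - k) * (A.card * B.card * C.card ^ (k - 2)) := by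
        rw [sum_const, smul_eq_mul, offDiag_card, card_univ, Fintype.card_fin]

end CountSharp

end Summit.PneNP.PneNP.Theorems
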